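import Literature.NumberTheory.QuadraticFields.PrincipalCycleIdentification
import Literature.NumberTheory.QuadraticFields.QuadraticIrrationalDuplication
import Literature.NumberTheory.QuadraticFields.QuadraticIrrationalGaussReduction
import Mathlib.Algebra.Squarefree.Basic
import HarnessLib

/-!
# The giant step of the infrastructure: square, reduce, and land on the principal cycle

Topic `NumberTheory/QuadraticFields`; assembles `QuadraticIrrationalDuplication.lean` (`dup`,
`latZ_mul_latZ`), `QuadraticIrrationalGaussReduction.lean` (`reduce`, `reduceMult`) and
`PrincipalCycleIdentification.lean` (`exists_iterate_eq_of_jmod_eq_smul`). Theorem-and-definition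
file (no named facts). For the principal expansion `x_n = stepⁿ δ` of a *fundamental*
discriminant `D` we prove

* `isIdealShaped_iterate` (the cycle elements are ideal-shaped: `Q` even, `2Q ∣ P² − D`) and
  `isPrimitive_of_isFundDiscr` (forms of a fundamental discriminant are primitive);
* `mul_mem_jmod_principalStart` (`O = ℤ + δℤ` is a ring) and
  **`mem_jmod_dup_iff : J(dup x_n) = g Π_n² · O`** (from `L(x)² = 2g·L(dup x)`, `L = Q·J`,
  `J(x_n) = Π_n O`: Jozsa §7.1 "`δ(I·I) = 2δ(I)`");
* **`giant_step`** (Jozsa §7.1 Prop. 35 / JW §7.4): the reduced representative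
  `w = reduce (dup x_n)` is a cycle element `x_m`, `1 ≤ m ≤ p`, with
  `Π_m εʲ = |reduceMult (dup x_n)| · g · Π_n²` for some `j ∈ ℤ` — i.e. its unrolled distance is
  `pos m ≡ 2·pos n + log g + log|μ| (mod R)` with the explicitly bounded correction
  `log g + log|μ|` (`g ≤ √D`-ish, `2^{-K} ≤ |μ| ≤ …`).

## References

* R. Jozsa, arXiv:quant-ph/0302134 (2003), §7.1 (Prop. 34, the construction of `I*I`, Prop. 35).
  [Jozsa2003]
* M. J. Jacobson, Jr., H. C. Williams, *Solving the Pell Equation*, Springer (2009), §5.4, §7.4.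
  [JacobsonWilliams2008]
-/

noncomputable section

open scoped Classical Pointwise

namespace Literature.NumberTheory.QuadraticFields

namespace QuadIrr

variable {D : ℕ}

/-! ### The cycle elements are ideal-shaped -/

/-- A pre-reduced ideal-shaped quotient steps to an ideal-shaped one (`Q` even makes
`P'² ≡ P² (mod 2Q)` and `Q'` even). [cite: Jozsa2003, §6.2 (ρ maps ideals to ideals, eq. (14))] -/
theorem IsIdealShaped.step (hD : ¬ IsSquare D) {x : QuadIrr D} (h : x.IsIdealShaped) (hpre : x.IsPreReduced) :
    (QuadIrr.step x).IsIdealShaped := by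
  obtain ⟨hQ, ⟨k, hk⟩, ⟨c, hc⟩⟩ := h
  have hred := hpre.isReduced_step hD
  have hmul := step_Q_mul_Q hpre.isAdmissible
  set x' := QuadIrr.step x with hx'
  have hP' : x'.P = x.pq * x.Q - x.P := step_P x
  -- `P'² − D = (P² − D) + Q(q²Q − 2qP)`, and `q²Q − 2qP` is even
  have h1 : 2 * x.Q ∣ x'.P ^ 2 - D := by
    have e : x'.P ^ 2 - (D : ℤ) = (x.P ^ 2 - D) + 2 * x.Q * (x.pq ^ 2 * k - x.pq * x.P) := by
      rw [hP', hk]; ring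
    rw [e, hc]
    exact dvd_add (dvd_mul_right _ _) (dvd_mul_right _ _)
  obtain ⟨c', hc'⟩ := h1
  -- `Q' Q = D − P'² = −2Q c'`, so `Q' = −2c'`
  have hQ' : x'.Q = -(2 * c') := by
    have : x'.Q * x.Q = -(2 * c') * x.Q := by rw [hmul]; linarith
    exact mul_right_cancel₀ hQ.ne' this
  refine ⟨hred.1, ⟨-c', by rw [hQ']; ring⟩, ?_⟩
  refine ⟨-k, ?_⟩
  rw [hk] at hmul
  linear_combination hmul

/-- The principal start `δ = (q, 2)` is ideal-shaped (`4 ∣ q² − D` as `D ≡ q² (mod 4)`). [cite: Jozsa2003, §6.3 (𝒪 = ℤ + ((τ(D,2)+√D)/2)ℤ is a reduced ideal)] -/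
theorem isIdealShaped_principalStart (hD4 : D % 4 = 0 ∨ D % 4 = 1) : (principalStart D).IsIdealShaped := by
  refine ⟨by simp [principalStart], ⟨1, by simp [principalStart]⟩, ?_⟩
  show 2 * (2 : ℤ) ∣ ((D % 2 : ℕ) : ℤ) ^ 2 - D
  have : ((D % 2 : ℕ) : ℤ) = (D : ℤ) % 2 := by push_cast; rfl
  rcases hD4 with h | h
  · have hq : ((D % 2 : ℕ) : ℤ) = 0 := by omega
    rw [hq]; omega
  · have hq : ((D % 2 : ℕ) : ℤ) = 1 := by omega
    rw [hq]; omega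

/-- **All elements `x₀, x₁, …` of the principal expansion are ideal-shaped.** [cite: Jozsa2003, §6.3 (the principal cycle consists of ideals of 𝒪)] -/
theorem isIdealShaped_iterate (hD : ¬ IsSquare D) (hD4 : D % 4 = 0 ∨ D % 4 = 1) :
    ∀ n : ℕ, (step^[n] (principalStart D)).IsIdealShaped
  | 0 => isIdealShaped_principalStart hD4
  | n + 1 => by
    rw [Function.iterate_succ_apply']
    have hpre : (step^[n] (principalStart D)).IsPreReduced := by
      rcases Nat.eq_zero_or_pos n with h0 | h0
      · rw [h0]; exact isPreReduced_principalStart hD hD4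
      · obtain ⟨m, rfl⟩ : ∃ m, n = m + 1 := ⟨n - 1, by omega⟩
        exact ((isPreReduced_principalStart hD hD4).isReduced_iterate_succ hD m).isPreReduced
    exact (isIdealShaped_iterate hD hD4 n).step hD hpre

/-! ### Fundamental discriminants: every ideal-shaped form is primitive -/

/-- Fundamental discriminant (as a natural number): `D ≡ 1 (mod 4)` squarefree, or `D = 4m` with
`m ≡ 2, 3 (mod 4)` squarefree. [cite: JacobsonWilliams2008, §4.2 (fundamental discriminant, after Def. 4.16)] -/
def IsFundDiscr (D : ℕ) : Prop :=
  (D % 4 = 1 ∧ Squarefree D) ∨ (4 ∣ D ∧ (D / 4 % 4 = 2 ∨ D / 4 % 4 = 3) ∧ Squarefree (D / 4))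

/-- **Forms of a fundamental discriminant are primitive**: a common prime `ℓ` of `(a, b, c)`
gives `ℓ² ∣ b² − 4ac = D`, impossible for odd `ℓ`, and for `ℓ = 2` it forces
`D/4 = b'² − 4a'c' ≡ 0, 1 (mod 4)`. [cite: JacobsonWilliams2008, §4.2 (Δ_K or Δ_K/4 squarefree)] -/
theorem isPrimitive_of_isFundDiscr (hF : IsFundDiscr D) {x : QuadIrr D} (h : x.IsIdealShaped) : x.IsPrimitive := by
  unfold IsPrimitive
  by_contra hne
  obtain ⟨ℓ, hℓ, hdvd⟩ := Nat.exists_prime_and_dvd hne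
  have hℓZ : Prime (ℓ : ℤ) := Nat.prime_iff_prime_int.mp hℓ
  have h3 : (ℓ : ℤ) ∣ (Int.gcd (Int.gcd (fa x) x.P) (fc x) : ℤ) := Int.natCast_dvd_natCast.mpr hdvd
  have ha : (ℓ : ℤ) ∣ fa x := h3.trans ((Int.gcd_dvd_left _ _).trans (Int.gcd_dvd_left _ _))
  have hb : (ℓ : ℤ) ∣ x.P := h3.trans ((Int.gcd_dvd_left _ _).trans (Int.gcd_dvd_right _ _))
  have hc : (ℓ : ℤ) ∣ fc x := h3.trans (Int.gcd_dvd_right _ _)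
  have hdisc := sq_sub_eq h   -- `P² − D = 4ac`
  obtain ⟨a', ha'⟩ := ha
  obtain ⟨b', hb'⟩ := hb
  obtain ⟨c', hc'⟩ := hc
  have hD : (D : ℤ) = ℓ ^ 2 * (b' ^ 2 - 4 * a' * c') := by
    rw [ha', hb', hc'] at hdisc; linear_combination -hdisc
  have hℓ2D : (ℓ : ℤ) ^ 2 ∣ D := ⟨_, hD⟩
  have hℓ2D' : ℓ ^ 2 ∣ D := by exact_mod_cast hℓ2D
  rcases hF with ⟨h1, hsq⟩ | ⟨h4, hm, hsq⟩
  · -- `D` squarefree: `ℓ² ∣ D` forces `ℓ = 1`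
    have := hsq ℓ (by rwa [← sq])
    exact hℓ.one_lt.ne' (Nat.isUnit_iff.mp this)
  · by_cases hℓ2 : ℓ = 2
    · subst hℓ2
      -- `D/4 = b'² − 4a'c' ≡ b'² (mod 4)`
      have hD4 : ((D / 4 : ℕ) : ℤ) = b' ^ 2 - 4 * a' * c' := by
        have : ((D / 4 : ℕ) : ℤ) * 4 = D := by exact_mod_cast Nat.div_mul_cancel h4
        push_cast at hD
        nlinarith [this, hD]
      have hsqmod : (b' ^ 2) % 4 = 0 ∨ (b' ^ 2) % 4 = 1 := by
        rcases Int.even_or_odd b' with ⟨r, hr⟩ | ⟨r, hr⟩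
        · left; rw [hr]; ring_nf; omega
        · right; rw [hr]; ring_nf; omega
      have hmZ : ((D / 4 : ℕ) : ℤ) % 4 = 2 ∨ ((D / 4 : ℕ) : ℤ) % 4 = 3 := by
        rcases hm with hm | hm
        · left; have := congrArg (fun n : ℕ => (n : ℤ)) hm; push_cast at this; exact this
        · right; have := congrArg (fun n : ℕ => (n : ℤ)) hm; push_cast at this; exact this
      have hdvd4 : (4 : ℤ) ∣ ((D / 4 : ℕ) : ℤ) - b' ^ 2 := ⟨-(a' * c'), by rw [hD4]; ring⟩
      generalize hB : b' ^ 2 = B at hdvd4 hsqmod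
      omega
    · -- odd `ℓ`: `ℓ² ∣ D = 4 (D/4)` gives `ℓ² ∣ D/4`, contradicting squarefreeness
      have hcop : Nat.Coprime (ℓ ^ 2) 4 := by
        have : Nat.Coprime ℓ 2 := (Nat.coprime_primes hℓ Nat.prime_two).mpr hℓ2
        simpa using this.pow 2 2
      have : ℓ ^ 2 ∣ D / 4 := by
        have hD' : D = 4 * (D / 4) := (Nat.mul_div_cancel' h4).symm
        rw [hD'] at hℓ2D'
        exact hcop.dvd_of_dvd_mul_left hℓ2D'
      have := hsq ℓ (by rwa [← sq])
      exact hℓ.one_lt.ne' (Nat.isUnit_iff.mp this)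

/-! ### `O` is a ring and `J(dup x_n) = g Π_n² O` -/

/-- **`O = ℤ + δℤ` is closed under multiplication** (`δ² = qδ + (D − q²)/4`).
[cite: JacobsonWilliams2008, §4.2 Thm. 4.17 (𝒪_Δ = [1, (Δ+√Δ)/2] is a ring)] -/
theorem mul_mem_jmod_principalStart (hD4 : D % 4 = 0 ∨ D % 4 = 1) {s t : ℝ}
    (hs : s ∈ jmod (principalStart D)) (ht : t ∈ jmod (principalStart D)) : s * t ∈ jmod (principalStart D) := by
  obtain ⟨m, n, rfl⟩ := mem_jmod_iff.mp hs
  obtain ⟨m', n', rfl⟩ := mem_jmod_iff.mp ht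
  set q : ℤ := ((D % 2 : ℕ) : ℤ) with hq
  obtain ⟨e, he⟩ : (4 : ℤ) ∣ (D : ℤ) - q ^ 2 := by
    have : ((D % 2 : ℕ) : ℤ) = (D : ℤ) % 2 := by push_cast; rfl
    rcases hD4 with h | h
    · have hq0 : q = 0 := by omega
      rw [hq0]; omega
    · have hq1 : q = 1 := by omega
      rw [hq1]; omega
  have hval : (principalStart D).val = (q + Real.sqrt D) / 2 := by unfold val principalStart; push_cast; rfl
  have hδ2 : (principalStart D).val ^ 2 = q * (principalStart D).val + e := by
    rw [hval]
    have hs2 : Real.sqrt (D : ℝ) ^ 2 = D := sqrt_sq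
    have he' : (D : ℝ) - (q : ℝ) ^ 2 = 4 * e := by exact_mod_cast he
    field_simp
    nlinarith [hs2, he']
  refine mem_jmod_iff.mpr ⟨m * m' + n * n' * e, m * n' + n * m' + n * n' * q, ?_⟩
  push_cast
  linear_combination (n * n' : ℝ) * hδ2

/-- `Π_n` and `g` are the scaling data; here `g = dupG x`, `Q = 2ga₁`, `Q' = 2a₁²`. The module of the
duplication of a cycle element: **`J(dup x_n) = g·Π_n²·O`**. [cite: Jozsa2003, §7.1 (I₂ = I·I, δ(I₂) = 2δ(I), and I₂' differing by the factor k')] -/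
theorem mem_jmod_dup_iff (hD : ¬ IsSquare D) (hD4 : D % 4 = 0 ∨ D % 4 = 1) (hF : IsFundDiscr D) (n : ℕ) (t : ℝ) :
    let x := step^[n] (principalStart D)
    t ∈ jmod (dup x) ↔ ∃ s ∈ jmod (principalStart D), t = dupG x * valProd (principalStart D) n ^ 2 * s := by
  intro x
  have h0 := isPreReduced_principalStart hD hD4
  have hsh : x.IsIdealShaped := isIdealShaped_iterate hD hD4 n
  have hprim : x.IsPrimitive := isPrimitive_of_isFundDiscr hF hsh
  obtain ⟨d⟩ := exists_dupData hprim
  obtain ⟨hP', hQ'⟩ := dup_P_Q hsh d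
  have hLL := latZ_mul_latZ hsh d
  have hg := dupG_pos hsh
  have ha1 := d.a₁_pos hsh
  have hQx : x.Q = 2 * dupG x * d.a₁ := by have := Q_eq_two_mul_fa hsh; rw [d.ha] at this; linarith
  have hQx0 : x.Q ≠ 0 := hsh.1.ne'
  have hQ'0 : (dup x).Q ≠ 0 := by rw [hQ']; positivity
  have hgR : (0 : ℝ) < dupG x := by exact_mod_cast hg
  have hPi := valProd_pos hD h0 n
  set Pn := valProd (principalStart D) n with hPndef
  set O := jmod (principalStart D) with hO
  -- elements of `L(x) = Q · J(x) = Q Π · O`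
  have hL : ∀ l, l ∈ latZ x ↔ ∃ s ∈ O, l = x.Q * Pn * s := by
    intro l
    rw [mem_latZ_iff_mem_jmod hQx0, mem_jmod_iterate_iff hD h0 n]
    have hQR : (x.Q : ℝ) ≠ 0 := by exact_mod_cast hQx0
    constructor
    · rintro ⟨s, hs, hls⟩
      exact ⟨s, hs, by field_simp at hls; linarith⟩
    · rintro ⟨s, hs, rfl⟩
      exact ⟨s, hs, by rw [hPndef]; field_simp⟩
  -- the key scalar identities: `Q² / (2gQ') = g` … in the form `Q² = g · (2gQ')`
  have hQQ : (x.Q : ℝ) ^ 2 = dupG x * (2 * dupG x * (dup x).Q) := by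
    rw [hQ', hQx]; push_cast; ring
  constructor
  · intro ht
    -- `2gQ' t ∈ span{2gQ', 2g(P'+√D)} = L·L`
    have hmem : 2 * (dupG x : ℝ) * (dup x).Q * t ∈ latZ x * latZ x := by
      rw [hLL]
      obtain ⟨m, k, rfl⟩ := mem_jmod_iff.mp ht
      rw [Submodule.mem_span_pair]
      refine ⟨m, k, ?_⟩
      simp only [zsmul_eq_mul]
      unfold val
      have : ((dup x).Q : ℝ) ≠ 0 := by exact_mod_cast hQ'0
      field_simp
    -- every element of `L·L` is `Q²Π² · (element of O)`
    have hprod : ∀ u ∈ latZ x * latZ x, ∃ s ∈ O, u = (x.Q : ℝ) ^ 2 * Pn ^ 2 * s := by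
      intro u hu
      unfold latZ at hu
      rw [Submodule.span_mul_span] at hu
      refine Submodule.span_induction ?_ ?_ ?_ ?_ hu
      · rintro u ⟨l₁, hl₁, l₂, hl₂, rfl⟩
        have hl₁' : l₁ ∈ latZ x := Submodule.subset_span hl₁
        have hl₂' : l₂ ∈ latZ x := Submodule.subset_span hl₂
        obtain ⟨s₁, hs₁, rfl⟩ := (hL l₁).mp hl₁'
        obtain ⟨s₂, hs₂, rfl⟩ := (hL l₂).mp hl₂'
        exact ⟨s₁ * s₂, mul_mem_jmod_principalStart hD4 hs₁ hs₂, by ring⟩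
      · exact ⟨0, O.zero_mem, by ring⟩
      · rintro u v - - ⟨s₁, hs₁, rfl⟩ ⟨s₂, hs₂, rfl⟩
        exact ⟨s₁ + s₂, O.add_mem hs₁ hs₂, by ring⟩
      · rintro k u - ⟨s, hs, rfl⟩
        refine ⟨k * s, ?_, by rw [zsmul_eq_mul]; ring⟩
        have := O.zsmul_mem hs k
        rwa [zsmul_eq_mul] at this
    obtain ⟨s, hs, hs'⟩ := hprod _ hmem
    refine ⟨s, hs, ?_⟩
    have h2gQ : (2 * (dupG x : ℝ) * (dup x).Q) ≠ 0 := by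
      have : ((dup x).Q : ℝ) ≠ 0 := by exact_mod_cast hQ'0
      positivity
    rw [hQQ] at hs'
    have : t = dupG x * Pn ^ 2 * s := by
      have := mul_left_cancel₀ h2gQ (by rw [hs']; ring : 2 * (dupG x : ℝ) * (dup x).Q * t = 2 * dupG x * (dup x).Q * (dupG x * Pn ^ 2 * s))
      exact this
    rw [this]
  · rintro ⟨s, hs, rfl⟩
    -- `gΠ²s = (g/Q²)·(QΠ)(QΠ s)` with `QΠ, QΠs ∈ L(x)`, and `L·L = 2gQ' · J(dup x)`
    have hl₁ : (x.Q : ℝ) * Pn ∈ latZ x := (hL _).mpr ⟨1, by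
      have := intCast_add_mul_val_mem_jmod (principalStart D) 1 0; simpa using this, by ring⟩
    have hl₂ : (x.Q : ℝ) * Pn * s ∈ latZ x := (hL _).mpr ⟨s, hs, rfl⟩
    have hmem := Submodule.mul_mem_mul hl₁ hl₂
    rw [hLL, Submodule.mem_span_pair] at hmem
    obtain ⟨m, k, hmk⟩ := hmem
    simp only [zsmul_eq_mul] at hmk
    rw [mem_jmod_iff]
    refine ⟨m, k, ?_⟩
    unfold val
    have hQ'R : ((dup x).Q : ℝ) ≠ 0 := by exact_mod_cast hQ'0
    have hQR : (x.Q : ℝ) ≠ 0 := by exact_mod_cast hQx0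
    -- from `m·2gQ' + k·2g(P'+√D) = QΠ · QΠ s = Q²Π² s = g(2gQ') Π² s`
    have key : (m : ℝ) * (2 * dupG x * (dup x).Q) + k * (2 * dupG x * ((dup x).P + Real.sqrt D)) =
        dupG x * (2 * dupG x * (dup x).Q) * (Pn ^ 2 * s) := by rw [hmk, ← hQQ]; ring
    have h2g : (2 * (dupG x : ℝ) * (dup x).Q) ≠ 0 := by positivity
    field_simp
    have := key
    field_simp at this
    linarith

/-! ### The giant step -/

/-- The one-step Gauss multiplier is in `ℚ(√D)`. [folklore] -/
theorem isQD_gaussFactor (x : QuadIrr D) : IsQD D (gaussFactor x) := by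
  unfold gaussFactor
  split_ifs
  · exact IsQD.intCast 1 |> fun h => by simpa using h
  · exact isQD_val _

/-- The reduction multiplier is in `ℚ(√D)`. [folklore] -/
theorem isQD_gaussMult : ∀ (n : ℕ) (x : QuadIrr D), IsQD D (gaussMult n x)
  | 0, x => by simpa [gaussMult] using IsQD.intCast (D := D) 1
  | n + 1, x => by
    simp only [gaussMult]
    exact (isQD_gaussMult n _).mul (isQD_gaussFactor x)

/-- `J(x) = J(−x)`-type symmetry: the set `κ·O` equals `(−κ)·O`. [folklore] -/
theorem exists_mem_neg_mul {O : AddSubgroup ℝ} {κ t : ℝ} :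
    (∃ s ∈ O, t = κ * s) ↔ ∃ s ∈ O, t = -κ * s := by
  constructor
  · rintro ⟨s, hs, rfl⟩; exact ⟨-s, O.neg_mem hs, by ring⟩
  · rintro ⟨s, hs, rfl⟩; exact ⟨-s, O.neg_mem hs, by ring⟩

/-- **The giant step** (square a cycle element, reduce, identify): for `n ≥ 0` and
`x = x_n = stepⁿ δ` of a fundamental discriminant, the reduced representative
`w = reduce (dup x)` is the cycle element `x_m` for some `1 ≤ m ≤ p`, and
`Π_m · εʲ = |reduceMult (dup x)| · g · Π_n²` for some `j ∈ ℤ` — the unrolled distance of the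
result is `2·pos + log g + log|μ|` modulo the regulator. [cite: Jozsa2003, §7.1 (the construction of I*I and Prop. 35)] -/
theorem giant_step (hD : ¬ IsSquare D) (hD4 : D % 4 = 0 ∨ D % 4 = 1) (hF : IsFundDiscr D) (n : ℕ) :
    let x := step^[n] (principalStart D)
    ∃ m : ℕ, 1 ≤ m ∧ m ≤ periodLength D ∧ reduce (dup x) = step^[m] (principalStart D) ∧
      ∃ j : ℤ, |reduceMult (dup x)| * dupG x * valProd (principalStart D) n ^ 2 =
        valProd (principalStart D) m * fundUnit D ^ j := by
  intro x
  have h0 := isPreReduced_principalStart hD hD4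
  have hsh : x.IsIdealShaped := isIdealShaped_iterate hD hD4 n
  have hprim : x.IsPrimitive := isPrimitive_of_isFundDiscr hF hsh
  obtain ⟨d⟩ := exists_dupData hprim
  have hsh' : (dup x).IsIdealShaped := isIdealShaped_dup hsh d
  have hadm' := hsh'.isAdmissible
  have hQ' := hsh'.1
  have hg := dupG_pos hsh
  have hgR : (0 : ℝ) < dupG x := by exact_mod_cast hg
  have hPi := valProd_pos hD h0 n
  set μ := reduceMult (dup x) with hμ
  have hμ0 : μ ≠ 0 := reduceMult_ne_zero hD hadm' hQ'
  set κ := |μ| * dupG x * valProd (principalStart D) n ^ 2 with hκ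
  have hκ0 : 0 < κ := by positivity
  have hκQ : IsQD D κ := by
    have hμQ : IsQD D |μ| := by
      rcases le_or_gt 0 μ with h | h
      · rw [abs_of_nonneg h]; exact isQD_gaussMult _ _
      · rw [abs_of_neg h]; exact (isQD_gaussMult _ _).neg
    exact (hμQ.mul (IsQD.intCast (dupG x))).mul ((isQD_valProd _ n).pow 2)
  -- `J(w) = κ · O`
  have hJ : ∀ t, t ∈ jmod (reduce (dup x)) ↔ ∃ s ∈ jmod (principalStart D), t = κ * s := by
    intro t
    rw [mem_jmod_reduce_iff hD hadm' hQ' t]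
    constructor
    · rintro ⟨s, hs, rfl⟩
      obtain ⟨s', hs', rfl⟩ := (mem_jmod_dup_iff hD hD4 hF n s).mp hs
      rcases le_or_gt 0 μ with h | h
      · refine ⟨s', hs', ?_⟩; rw [hκ, abs_of_nonneg h, hμ]; ring
      · refine ⟨-s', (jmod (principalStart D)).neg_mem hs', ?_⟩; rw [hκ, abs_of_neg h, hμ]; ring
    · rintro ⟨s', hs', rfl⟩
      rcases le_or_gt 0 μ with h | h
      · refine ⟨dupG x * valProd (principalStart D) n ^ 2 * s', (mem_jmod_dup_iff hD hD4 hF n _).mpr ⟨s', hs', rfl⟩, ?_⟩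
        rw [hκ, abs_of_nonneg h, hμ]; ring
      · refine ⟨dupG x * valProd (principalStart D) n ^ 2 * (-s'),
          (mem_jmod_dup_iff hD hD4 hF n _).mpr ⟨-s', (jmod (principalStart D)).neg_mem hs', rfl⟩, ?_⟩
        rw [hκ, abs_of_neg h, hμ]; ring
  obtain ⟨m, hm1, hmp, hw, j, hj⟩ :=
    exists_iterate_eq_of_jmod_eq_smul hD hD4 (isReduced_reduce hD hadm' hQ') hκ0 hκQ hJ
  exact ⟨m, hm1, hmp, hw, j, hj⟩

end QuadIrr

end Literature.NumberTheory.QuadraticFields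

end
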